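import Literature.AlgebraicGeometry.AbelianSchemes.IdealTorsionPointsCoprimeSplitting   -- ★ §1 pointwise laws of `ι` on `Ω`-points (`comp_i_mul_pt`, `comp_i_eq_self_of_torsion_of_sub_one_mem`, …)
import Literature.AlgebraicGeometry.AbelianSchemes.DualIsogenyDegree                    -- ★ `homOfIsMonHom` (points of a homomorphism)
import Literature.AlgebraicGeometry.Motives.AbelianVarietyHomDivisionOnPoints           -- ★ `map_hom_mul`
import Literature.AlgebraicGeometry.Motives.AlgPointsMapSurjectiveAlgClosed             -- ★ `AlgPoints.map_surjective_of_surjective_of_isAlgClosed'` (points lift along surjective `c`)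
import Mathlib.GroupTheory.Index
import HarnessLib

/-!
# The IMAGE LINE of an isogeny roof `A —q→ B ←c— A″`: the `𝔞`-torsion points `P″` of `A″` with `c P″ ∈ q(A[𝔞])` — injectivity of `c` on `A″[𝔞]`,
# the torsion LIFT through `c`, `ι`-stability, and the COUNT `#Img · #(Ker q ∩ A[𝔞]) = #A[𝔞]` ([Liu2021] Prop. D.8; [MumfordAV1970] §7 Thm. 4)

Topic `AlgebraicGeometry/AbelianSchemes`, namespace `Literature.AlgebraicGeometry.AbelianSchemes.AbelianSchemeOver`.  THEOREMS ONLY (no definition, no named fact,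
no `instance`, no notation, no `sorry`).  Cell `hodgecm-mathlib` (D-0151), F0∕P6 «MOD», line L2 (socket `stub_SPEC`), organ **(HC2-img)∕(J1)** «the image line is a
line» (LA2-plan (g2) deal 2026-09-02T08:56:42Z (2), currency ruling 09:03:29Z (1) → B-p08 (g35)); `--supports stmt-HodgeConjecture-24832`, count-neutral.  HONEST LABEL:
HC_CM is proved only modulo the cell's 2 remaining named inputs (hLiu418 24832, h413 24833) until rung 0 closes; this file is generic and discharges none of them.

## Mathematics (all on `Ω`-points; `Ω = Ω̄` only for the lift)

Abelian `Ω`-schemes `A, A″, B` with actions `ι, ι″` of a commutative ring `𝒪`, homomorphisms `q : A → B`, `c : A″ → B`, two COMAXIMAL ideals `𝔭 + 𝔞 = 𝒪` and the roof rows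
(r1) `q P = 1 ↔ P ∈ K`, (r2) `c P″ = 1 ↔ ι″(𝔭) P″ = 1`, `c` surjective, (r4) `ι(a) ≫ q = q ≫ b_a`, `ι″(a) ≫ c = c ≫ b_a` (common intertwiners; `b_a` need NOT be a
homomorphism).  The IMAGE LINE is the set `Img := {P″ ∈ A″[𝔞] | ∃ P ∈ A[𝔞], c P″ = q P}` (for the P6a roofs: `𝔭 = 𝔭_w`, `𝔞 = 𝔭_{c•w}`, `Img = r₁(A_y[𝔭_{c•w}])`).
* `c` is INJECTIVE on `A″[𝔞]`: a point killed by `ι″(𝔭)` (the kernel of `c`) and by `ι″(𝔞)` is killed by `ι″(𝔭 + 𝔞) = ι″(𝒪) ∋ ι″(1)`.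
* LIFT: for `P ∈ A[𝔞]` there is `P″ ∈ A″[𝔞]` with `c P″ = q P` — lift `q P` to `x ∈ A″(Ω̄)` (`c` is onto on `Ω̄`-points); for `a ∈ 𝔞`, `c(ι″(a)x) = b_a(c x) = b_a(q P) =
  q(ι(a)P) = q(1) = 1`, so `ι″(𝔭𝔞) x = 1`; with `1 = u + v`, `u ∈ 𝔭`, `v ∈ 𝔞` put `P″ := ι″(u) x`: it is killed by `𝔞` (`𝔞u ⊆ 𝔭𝔞`) and `c P″ = b_u(q P) = q(ι(u)P) = q P`
  (`ι(u)P = ι(1 - v)P = P`).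
* `Img` is a SUBGROUP (multiplicativity) and `ι″`-STABLE: `c(ι″(a)P″) = b_a(c P″) = b_a(q P) = q(ι(a) P)`.
* COUNT: `P″ ↦ c P″` is a bijection `Img ≃ q(A[𝔞])` (injective by the first point, onto by the lift), and `q|_{A[𝔞]}` has kernel `K ∩ A[𝔞] =: L`, so
  `#Img · #L = #q(A[𝔞]) · #Ker(q|_{A[𝔞]}) = #A[𝔞]` (Mathlib `Subgroup.card_mul_index`, `Subgroup.index_ker`).  For the P6a roofs `#A_y[𝔭_{c•w}] = p^{2f}` (★ (LAT-C)) and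
  `#L = p^f`, so `#Img = p^f`: the image line IS a line.

## Contents
* §1 `forall_mem_mul_of_forall_forall'` (bookkeeping: `ι(I)ι(J)` kills ⇒ `ι(IJ)` kills), `map_i_eq_one_of_map_eq_one_of_intertwined` (`c(ι″(a)x) = 1` when `c x = q P`, `ι(a)P = 1`).
* §2 **`eq_one_of_torsion_of_map_eq_one`**, **`eq_of_torsion_of_map_eq`** (injectivity of `c` on `A″[𝔞]`).
* §3 **`exists_torsion_map_eq_map_of_torsion`** (the lift; `Ω` algebraically closed).
* §4 **`imgLine_one`**, **`imgLine_mul`**, **`imgLine_inv`**, **`map_i_imgLine`** (subgroup + stability of the membership formula).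
* §5 **`natCard_imgLine_mul_natCard_eq`** — THE COUNT `#Img · #L = #A[𝔞]`, and **`natCard_imgLine_eq_of_sq`** (`#A[𝔞] = n·n`, `#L = n`, `0 < n` ⟹ `#Img = n`).

## References
* [Liu2021] Y. Liu, *Fourier–Jacobi cycles and arithmetic relative trace formula*, Camb. J. Math. 9 (2021), App. D, Prop. D.8 (1)(2) (p. 135), pp. 136–138.
* [MumfordAV1970] D. Mumford, *Abelian Varieties* (1970), §4 Cor. 1 (p. 43), §7 Thm. 4 (p. 72), §19 Thm. 3 (p. 176).
* [HarrisTaylorAMS2001] M. Harris, R. Taylor, *The geometry and cohomology of some simple Shimura varieties* (2001), §III.4 (pp. 108–110).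
* [AtiyahMacdonald1969] M. Atiyah, I. Macdonald, *Introduction to Commutative Algebra* (1969), Prop. 1.10.
-/

set_option autoImplicit false

noncomputable section

-- Mathlib's `Over`/pull-back API and the ★ points readers (`toAffine.toAbelianVariety.Points`) are stated across semireducible wrappers (as in the ★ `AbelianSchemes/*` files).
set_option backward.isDefEq.respectTransparency false

universe u

open CategoryTheory CategoryTheory.Limits AlgebraicGeometry MonoidalCategory CartesianMonoidalCategory
open scoped MonObj
open Literature.AlgebraicGeometry.Motives (AlgPoints SchemeOver specOver)

namespace Literature.AlgebraicGeometry.AbelianSchemes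

namespace AbelianSchemeOver

variable {Ω : Type u} [Field Ω] {A A'' B : AbelianSchemeOver (Spec (.of Ω))} {O : Type*} [CommRing O]
  (act : A.RingAction O) (act'' : A''.RingAction O)
  (q : A.X ⟶ B.X) [IsMonHom q] (c : A''.X ⟶ B.X) [IsMonHom c]

/-! ## §1 Bookkeeping -/

/-- If `(x ≫ ι u) ≫ ι b = 1` for all `u ∈ I`, `b ∈ J`, then `ι(m)` kills `x` for all `m ∈ I * J` (products generate, `ι` additive).
[cite: MumfordAV1970, §19 Thm. 3 (p. 176)] -/
theorem forall_mem_mul_of_forall_forall' (x : specOver Ω Ω ⟶ A.X) {I J : Ideal O}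
    (h : ∀ u ∈ I, ∀ b ∈ J, (x ≫ act.i u) ≫ act.i b = 1) : ∀ m ∈ I * J, x ≫ act.i m = 1 := by
  intro m hm
  refine Submodule.mul_induction_on hm (fun u hu b hb => ?_) (fun a b ha hb => ?_)
  · rw [mul_comm, RingAction.comp_i_mul_pt]; exact h u hu b hb
  · rw [RingAction.comp_i_add_pt, ha, hb, mul_one]

/-- Points of a homomorphism are multiplicative: `ψ(P·Q) = ψ(P)·ψ(Q)` (★ `homOfIsMonHom`, ★ `map_hom_mul`). [cite: MumfordAV1970, §4 Cor. 1 (p. 43)] -/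
theorem map_pt_mul' {A₁ B₁ : AbelianSchemeOver (Spec (.of Ω))} (ψ : A₁.X ⟶ B₁.X) [IsMonHom ψ] (P Q : A₁.toAffine.toAbelianVariety.Points Ω) :
    (AlgPoints.map ψ (P * Q) : B₁.toAffine.toAbelianVariety.Points Ω) = AlgPoints.map ψ P * AlgPoints.map ψ Q :=
  Literature.AlgebraicGeometry.Motives.AbelianVariety.map_hom_mul (homOfIsMonHom ψ) P Q

/-- `ψ(1) = 1` on points. [cite: MumfordAV1970, §4 Cor. 1 (p. 43)] -/
theorem map_pt_one' {A₁ B₁ : AbelianSchemeOver (Spec (.of Ω))} (ψ : A₁.X ⟶ B₁.X) [IsMonHom ψ] :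
    (AlgPoints.map ψ (1 : A₁.toAffine.toAbelianVariety.Points Ω) : B₁.toAffine.toAbelianVariety.Points Ω) = 1 :=
  MonObj.one_comp ψ

/-- `ψ(P⁻¹) = ψ(P)⁻¹` on points. [cite: MumfordAV1970, §4 Cor. 1 (p. 43)] -/
theorem map_pt_inv' {A₁ B₁ : AbelianSchemeOver (Spec (.of Ω))} (ψ : A₁.X ⟶ B₁.X) [IsMonHom ψ] (P : A₁.toAffine.toAbelianVariety.Points Ω) :
    (AlgPoints.map ψ P⁻¹ : B₁.toAffine.toAbelianVariety.Points Ω) = (AlgPoints.map ψ P)⁻¹ := by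
  have h := map_pt_mul' ψ P⁻¹ P
  rw [inv_mul_cancel, map_pt_one'] at h
  exact eq_inv_of_mul_eq_one_left h.symm

omit [IsMonHom c] in
/-- **`c(ι″(a) x) = 1` when `c x = q P` and `ι(a) P = 1`**, for a common intertwiner `b_a` (`(x ≫ ι″a) ≫ c = x ≫ c ≫ b_a = (P ≫ q) ≫ b_a = (P ≫ ι a) ≫ q = 1 ≫ q`).
[cite: MumfordAV1970, §7 Thm. 4 (p. 72)] -/
theorem map_i_eq_one_of_map_eq_one_of_intertwined {a : O} {b : B.X ⟶ B.X} (hbq : act.i a ≫ q = q ≫ b) (hbc : act''.i a ≫ c = c ≫ b)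
    {P : A.toAffine.toAbelianVariety.Points Ω} {x : A''.toAffine.toAbelianVariety.Points Ω}
    (hx : (AlgPoints.map c x : B.toAffine.toAbelianVariety.Points Ω) = AlgPoints.map q P)
    (hP : (AlgPoints.map (act.i a) P : A.toAffine.toAbelianVariety.Points Ω) = 1) :
    (AlgPoints.map c (AlgPoints.map (act''.i a) x : A''.toAffine.toAbelianVariety.Points Ω) : B.toAffine.toAbelianVariety.Points Ω) = 1 := by
  change ((x : specOver Ω Ω ⟶ A''.X) ≫ act''.i a) ≫ c = 1
  change (x : specOver Ω Ω ⟶ A''.X) ≫ c = (P : specOver Ω Ω ⟶ A.X) ≫ q at hx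
  change (P : specOver Ω Ω ⟶ A.X) ≫ act.i a = 1 at hP
  rw [Category.assoc, hbc, ← Category.assoc, hx, Category.assoc, ← hbq, ← Category.assoc, hP, MonObj.one_comp]

omit [IsMonHom q] [IsMonHom c] in
/-- **`c(ι″(a) P″) = q(ι(a) P)` when `c P″ = q P`**, for a common intertwiner. [cite: MumfordAV1970, §7 Thm. 4 (p. 72)] -/
theorem map_map_i_eq_of_intertwined {a : O} {b : B.X ⟶ B.X} (hbq : act.i a ≫ q = q ≫ b) (hbc : act''.i a ≫ c = c ≫ b)
    {P : A.toAffine.toAbelianVariety.Points Ω} {x : A''.toAffine.toAbelianVariety.Points Ω}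
    (hx : (AlgPoints.map c x : B.toAffine.toAbelianVariety.Points Ω) = AlgPoints.map q P) :
    (AlgPoints.map c (AlgPoints.map (act''.i a) x : A''.toAffine.toAbelianVariety.Points Ω) : B.toAffine.toAbelianVariety.Points Ω) =
      AlgPoints.map q (AlgPoints.map (act.i a) P : A.toAffine.toAbelianVariety.Points Ω) := by
  change ((x : specOver Ω Ω ⟶ A''.X) ≫ act''.i a) ≫ c = ((P : specOver Ω Ω ⟶ A.X) ≫ act.i a) ≫ q
  change (x : specOver Ω Ω ⟶ A''.X) ≫ c = (P : specOver Ω Ω ⟶ A.X) ≫ q at hx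
  rw [Category.assoc, hbc, ← Category.assoc, hx, Category.assoc, ← hbq, Category.assoc]

/-! ## §2 `c` is injective on `A″[𝔞]` when `Ker c = A″[𝔭]` and `𝔭 + 𝔞 = 𝒪` -/

/-- A point killed by two COMAXIMAL ideals is trivial: `1 = u + v`, `x = x ≫ ι(1) = (x ≫ ι u)·(x ≫ ι v) = 1`. [cite: MumfordAV1970, §19 Thm. 3 (p. 176)] -/
theorem eq_one_of_forall_mem_of_forall_mem_of_sup_eq_top {𝔭 𝔞 : Ideal O} (h𝔭𝔞 : 𝔭 ⊔ 𝔞 = ⊤) (x : specOver Ω Ω ⟶ A.X)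
    (h𝔭 : ∀ a ∈ 𝔭, x ≫ act.i a = 1) (h𝔞 : ∀ a ∈ 𝔞, x ≫ act.i a = 1) : x = 1 := by
  obtain ⟨u, hu, v, hv, huv⟩ := Submodule.mem_sup.mp ((Ideal.eq_top_iff_one _).mp h𝔭𝔞)
  rw [← (act.comp_i_zero_one x).2, ← huv, act.comp_i_add, h𝔭 u hu, h𝔞 v hv, mul_one]

omit [IsMonHom c] in
/-- **A point of `A″[𝔞]` killed by `c` is trivial** (`Ker c(Ω) = A″[𝔭]`, `𝔭 ⊔ 𝔞 = ⊤`). [cite: MumfordAV1970, §7 Thm. 4 (p. 72), §19 Thm. 3 (p. 176)] -/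
theorem eq_one_of_torsion_of_map_eq_one {𝔭 𝔞 : Ideal O} (h𝔭𝔞 : 𝔭 ⊔ 𝔞 = ⊤)
    (h2 : ∀ P : A''.toAffine.toAbelianVariety.Points Ω,
      (AlgPoints.map c P : B.toAffine.toAbelianVariety.Points Ω) = 1 ↔
        ∀ a ∈ 𝔭, (AlgPoints.map (act''.i a) P : A''.toAffine.toAbelianVariety.Points Ω) = 1)
    {P : A''.toAffine.toAbelianVariety.Points Ω}
    (hP : ∀ a ∈ 𝔞, (AlgPoints.map (act''.i a) P : A''.toAffine.toAbelianVariety.Points Ω) = 1)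
    (hc : (AlgPoints.map c P : B.toAffine.toAbelianVariety.Points Ω) = 1) : P = 1 :=
  eq_one_of_forall_mem_of_forall_mem_of_sup_eq_top act'' h𝔭𝔞 P ((h2 P).1 hc) hP

/-- **`c` IS INJECTIVE ON `A″[𝔞]`** (`Ker c(Ω) = A″[𝔭]`, `𝔭 ⊔ 𝔞 = ⊤`). [cite: MumfordAV1970, §7 Thm. 4 (p. 72), §19 Thm. 3 (p. 176)] -/
theorem eq_of_torsion_of_map_eq {𝔭 𝔞 : Ideal O} (h𝔭𝔞 : 𝔭 ⊔ 𝔞 = ⊤)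
    (h2 : ∀ P : A''.toAffine.toAbelianVariety.Points Ω,
      (AlgPoints.map c P : B.toAffine.toAbelianVariety.Points Ω) = 1 ↔
        ∀ a ∈ 𝔭, (AlgPoints.map (act''.i a) P : A''.toAffine.toAbelianVariety.Points Ω) = 1)
    {P Q : A''.toAffine.toAbelianVariety.Points Ω}
    (hP : ∀ a ∈ 𝔞, (AlgPoints.map (act''.i a) P : A''.toAffine.toAbelianVariety.Points Ω) = 1)
    (hQ : ∀ a ∈ 𝔞, (AlgPoints.map (act''.i a) Q : A''.toAffine.toAbelianVariety.Points Ω) = 1)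
    (hc : (AlgPoints.map c P : B.toAffine.toAbelianVariety.Points Ω) = AlgPoints.map c Q) : P = Q := by
  have hPQ : ∀ a ∈ 𝔞, (AlgPoints.map (act''.i a) (P * Q⁻¹) : A''.toAffine.toAbelianVariety.Points Ω) = 1 := fun a ha => by
    haveI := act''.isMonHom a
    rw [map_pt_mul', map_pt_inv', hP a ha, hQ a ha, inv_one, mul_one]
  have hcPQ : (AlgPoints.map c (P * Q⁻¹) : B.toAffine.toAbelianVariety.Points Ω) = 1 := by
    rw [map_pt_mul', map_pt_inv', hc, mul_inv_cancel]
  exact mul_inv_eq_one.mp (eq_one_of_torsion_of_map_eq_one act'' c h𝔭𝔞 h2 hPQ hcPQ)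

/-! ## §3 The torsion LIFT through `c` (`Ω` algebraically closed) -/

omit [IsMonHom c] in
set_option maxHeartbeats 400000 in
/-- **THE `𝔞`-TORSION LIFT: every `q P`, `P ∈ A[𝔞]`, is `c P″` for some `P″ ∈ A″[𝔞]`** (`c` onto on `Ω̄`-points; `ι″(𝔭𝔞)` kills any lift `x` of `q P`; project by
`ι″(u)`, `1 = u + v`, `u ∈ 𝔭`, `v ∈ 𝔞`: `c(ι″(u)x) = q(ι(u)P) = q P`). [cite: Liu2021, Prop. D.8 (1)(2) p. 135] [cite: MumfordAV1970, §7 Thm. 4 (p. 72)] [cite: AtiyahMacdonald1969, Prop. 1.10] -/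
theorem exists_torsion_map_eq_map_of_torsion [IsAlgClosed Ω] {𝔭 𝔞 : Ideal O} (h𝔭𝔞 : 𝔭 ⊔ 𝔞 = ⊤)
    (h2 : ∀ P : A''.toAffine.toAbelianVariety.Points Ω,
      (AlgPoints.map c P : B.toAffine.toAbelianVariety.Points Ω) = 1 ↔
        ∀ a ∈ 𝔭, (AlgPoints.map (act''.i a) P : A''.toAffine.toAbelianVariety.Points Ω) = 1)
    (h2s : Function.Surjective c.left.base)
    (h4 : ∀ a : O, ∃ b : B.X ⟶ B.X, act.i a ≫ q = q ≫ b ∧ act''.i a ≫ c = c ≫ b)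
    {P : A.toAffine.toAbelianVariety.Points Ω}
    (hP : ∀ a ∈ 𝔞, (AlgPoints.map (act.i a) P : A.toAffine.toAbelianVariety.Points Ω) = 1) :
    ∃ P'' : A''.toAffine.toAbelianVariety.Points Ω,
      (∀ a ∈ 𝔞, (AlgPoints.map (act''.i a) P'' : A''.toAffine.toAbelianVariety.Points Ω) = 1) ∧
      (AlgPoints.map c P'' : B.toAffine.toAbelianVariety.Points Ω) = AlgPoints.map q P := by
  haveI : Surjective c.left := ⟨h2s⟩
  -- lift `q P` along `c`
  obtain ⟨x, hx⟩ := AlgPoints.map_surjective_of_surjective_of_isAlgClosed' (L := Ω)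
    (X := A''.toAffine.toAbelianVariety.X) (Y := B.toAffine.toAbelianVariety.X) c (AlgPoints.map q P)
  have hx' : (x : specOver Ω Ω ⟶ A''.X) ≫ c = (P : specOver Ω Ω ⟶ A.X) ≫ q := hx
  -- `ι″(𝔭𝔞)` kills `x`: for `a ∈ 𝔞`, `c(ι″(a)x) = 1`, so `ι″(𝔭)` kills `ι″(a) x`
  have hx𝔞𝔭 : ∀ m ∈ 𝔞 * 𝔭, (x : specOver Ω Ω ⟶ A''.X) ≫ act''.i m = 1 := by
    refine forall_mem_mul_of_forall_forall' act'' x fun a ha π hπ => ?_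
    obtain ⟨b, hbq, hbc⟩ := h4 a
    have h1 : (AlgPoints.map c (AlgPoints.map (act''.i a) x : A''.toAffine.toAbelianVariety.Points Ω) :
        B.toAffine.toAbelianVariety.Points Ω) = 1 :=
      map_i_eq_one_of_map_eq_one_of_intertwined act act'' q c hbq hbc hx (hP a ha)
    exact (h2 _).1 h1 π hπ
  -- the CRT element
  obtain ⟨u, hu, v, hv, huv⟩ := Submodule.mem_sup.mp ((Ideal.eq_top_iff_one _).mp h𝔭𝔞)
  obtain ⟨b, hbq, hbc⟩ := h4 u
  refine ⟨AlgPoints.map (act''.i u) x, fun a ha => ?_, ?_⟩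
  · -- `(x ≫ ι″u) ≫ ι″a = x ≫ ι″(a u) = 1`, `a u ∈ 𝔞𝔭`
    change ((x : specOver Ω Ω ⟶ A''.X) ≫ act''.i u) ≫ act''.i a = 1
    rw [← RingAction.comp_i_mul_pt]
    exact hx𝔞𝔭 _ (Ideal.mul_mem_mul ha hu)
  · -- `c(ι″(u) x) = q(ι(u) P) = q P`
    have hPu : (AlgPoints.map (act.i u) P : A.toAffine.toAbelianVariety.Points Ω) = P := by
      change (P : specOver Ω Ω ⟶ A.X) ≫ act.i u = P
      refine RingAction.comp_i_eq_self_of_torsion_of_sub_one_mem act (𝔞 := 𝔞) ?_ P hP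
      have : u - 1 = -v := by rw [← huv]; ring
      rw [this]; exact 𝔞.neg_mem hv
    rw [map_map_i_eq_of_intertwined act act'' q c hbq hbc hx, hPu]

/-! ## §4 The membership formula of the image line is a subgroup condition, stable under `ι″` -/

/-- `1 ∈ Img`. [cite: Liu2021, Prop. D.8 (1)(2) p. 135] -/
theorem imgLine_one (𝔞 : Ideal O) :
    (∀ a ∈ 𝔞, (AlgPoints.map (act''.i a) (1 : A''.toAffine.toAbelianVariety.Points Ω) : A''.toAffine.toAbelianVariety.Points Ω) = 1) ∧
      ∃ P : A.toAffine.toAbelianVariety.Points Ω, (∀ a ∈ 𝔞, (AlgPoints.map (act.i a) P : A.toAffine.toAbelianVariety.Points Ω) = 1) ∧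
        (AlgPoints.map c (1 : A''.toAffine.toAbelianVariety.Points Ω) : B.toAffine.toAbelianVariety.Points Ω) = AlgPoints.map q P := by
  refine ⟨fun a _ => ?_, 1, fun a _ => ?_, ?_⟩
  · haveI := act''.isMonHom a; exact map_pt_one' _
  · haveI := act.isMonHom a; exact map_pt_one' _
  · rw [map_pt_one', map_pt_one']

/-- `Img` is closed under multiplication. [cite: Liu2021, Prop. D.8 (1)(2) p. 135] -/
theorem imgLine_mul (𝔞 : Ideal O) {P'' Q'' : A''.toAffine.toAbelianVariety.Points Ω} {P Q : A.toAffine.toAbelianVariety.Points Ω}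
    (hP'' : ∀ a ∈ 𝔞, (AlgPoints.map (act''.i a) P'' : A''.toAffine.toAbelianVariety.Points Ω) = 1)
    (hQ'' : ∀ a ∈ 𝔞, (AlgPoints.map (act''.i a) Q'' : A''.toAffine.toAbelianVariety.Points Ω) = 1)
    (hP : ∀ a ∈ 𝔞, (AlgPoints.map (act.i a) P : A.toAffine.toAbelianVariety.Points Ω) = 1)
    (hQ : ∀ a ∈ 𝔞, (AlgPoints.map (act.i a) Q : A.toAffine.toAbelianVariety.Points Ω) = 1)
    (hcP : (AlgPoints.map c P'' : B.toAffine.toAbelianVariety.Points Ω) = AlgPoints.map q P)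
    (hcQ : (AlgPoints.map c Q'' : B.toAffine.toAbelianVariety.Points Ω) = AlgPoints.map q Q) :
    (∀ a ∈ 𝔞, (AlgPoints.map (act''.i a) (P'' * Q'') : A''.toAffine.toAbelianVariety.Points Ω) = 1) ∧
      (∀ a ∈ 𝔞, (AlgPoints.map (act.i a) (P * Q) : A.toAffine.toAbelianVariety.Points Ω) = 1) ∧
      (AlgPoints.map c (P'' * Q'') : B.toAffine.toAbelianVariety.Points Ω) = AlgPoints.map q (P * Q) := by
  refine ⟨fun a ha => ?_, fun a ha => ?_, ?_⟩
  · haveI := act''.isMonHom a; rw [map_pt_mul', hP'' a ha, hQ'' a ha, mul_one]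
  · haveI := act.isMonHom a; rw [map_pt_mul', hP a ha, hQ a ha, mul_one]
  · rw [map_pt_mul', map_pt_mul', hcP, hcQ]

/-- `Img` is closed under inverses. [cite: Liu2021, Prop. D.8 (1)(2) p. 135] -/
theorem imgLine_inv (𝔞 : Ideal O) {P'' : A''.toAffine.toAbelianVariety.Points Ω} {P : A.toAffine.toAbelianVariety.Points Ω}
    (hP'' : ∀ a ∈ 𝔞, (AlgPoints.map (act''.i a) P'' : A''.toAffine.toAbelianVariety.Points Ω) = 1)
    (hP : ∀ a ∈ 𝔞, (AlgPoints.map (act.i a) P : A.toAffine.toAbelianVariety.Points Ω) = 1)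
    (hcP : (AlgPoints.map c P'' : B.toAffine.toAbelianVariety.Points Ω) = AlgPoints.map q P) :
    (∀ a ∈ 𝔞, (AlgPoints.map (act''.i a) P''⁻¹ : A''.toAffine.toAbelianVariety.Points Ω) = 1) ∧
      (∀ a ∈ 𝔞, (AlgPoints.map (act.i a) P⁻¹ : A.toAffine.toAbelianVariety.Points Ω) = 1) ∧
      (AlgPoints.map c P''⁻¹ : B.toAffine.toAbelianVariety.Points Ω) = AlgPoints.map q P⁻¹ := by
  refine ⟨fun a ha => ?_, fun a ha => ?_, ?_⟩
  · haveI := act''.isMonHom a; rw [map_pt_inv', hP'' a ha, inv_one]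
  · haveI := act.isMonHom a; rw [map_pt_inv', hP a ha, inv_one]
  · rw [map_pt_inv', map_pt_inv', hcP]

omit [IsMonHom q] [IsMonHom c] in
/-- **`Img` IS `ι″`-STABLE**: if `P″ ∈ A″[𝔞]`, `P ∈ A[𝔞]`, `c P″ = q P` then `ι″(a)P″ ∈ A″[𝔞]`, `ι(a)P ∈ A[𝔞]` and `c(ι″(a)P″) = q(ι(a)P)` (common intertwiner; `𝒪`
commutative). [cite: Liu2021, Prop. D.8 (1)(2) p. 135] [cite: MumfordAV1970, §7 Thm. 4 (p. 72)] -/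
theorem map_i_imgLine (𝔞 : Ideal O) (h4 : ∀ a : O, ∃ b : B.X ⟶ B.X, act.i a ≫ q = q ≫ b ∧ act''.i a ≫ c = c ≫ b) (a : O)
    {P'' : A''.toAffine.toAbelianVariety.Points Ω} {P : A.toAffine.toAbelianVariety.Points Ω}
    (hP'' : ∀ a ∈ 𝔞, (AlgPoints.map (act''.i a) P'' : A''.toAffine.toAbelianVariety.Points Ω) = 1)
    (hP : ∀ a ∈ 𝔞, (AlgPoints.map (act.i a) P : A.toAffine.toAbelianVariety.Points Ω) = 1)
    (hcP : (AlgPoints.map c P'' : B.toAffine.toAbelianVariety.Points Ω) = AlgPoints.map q P) :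
    (∀ a' ∈ 𝔞, (AlgPoints.map (act''.i a') (AlgPoints.map (act''.i a) P'' : A''.toAffine.toAbelianVariety.Points Ω) :
        A''.toAffine.toAbelianVariety.Points Ω) = 1) ∧
      (∀ a' ∈ 𝔞, (AlgPoints.map (act.i a') (AlgPoints.map (act.i a) P : A.toAffine.toAbelianVariety.Points Ω) :
        A.toAffine.toAbelianVariety.Points Ω) = 1) ∧
      (AlgPoints.map c (AlgPoints.map (act''.i a) P'' : A''.toAffine.toAbelianVariety.Points Ω) : B.toAffine.toAbelianVariety.Points Ω) =
        AlgPoints.map q (AlgPoints.map (act.i a) P : A.toAffine.toAbelianVariety.Points Ω) := by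
  obtain ⟨b, hbq, hbc⟩ := h4 a
  refine ⟨fun a' ha' => ?_, fun a' ha' => ?_, map_map_i_eq_of_intertwined act act'' q c hbq hbc hcP⟩
  · change ((P'' : specOver Ω Ω ⟶ A''.X) ≫ act''.i a) ≫ act''.i a' = 1
    rw [← RingAction.comp_i_mul_pt, mul_comm, RingAction.comp_i_mul_pt]
    change (AlgPoints.map (act''.i a) (AlgPoints.map (act''.i a') P'' : A''.toAffine.toAbelianVariety.Points Ω) :
      A''.toAffine.toAbelianVariety.Points Ω) = 1
    haveI := act''.isMonHom a
    rw [hP'' a' ha', map_pt_one']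
  · change ((P : specOver Ω Ω ⟶ A.X) ≫ act.i a) ≫ act.i a' = 1
    rw [← RingAction.comp_i_mul_pt, mul_comm, RingAction.comp_i_mul_pt]
    change (AlgPoints.map (act.i a) (AlgPoints.map (act.i a') P : A.toAffine.toAbelianVariety.Points Ω) :
      A.toAffine.toAbelianVariety.Points Ω) = 1
    haveI := act.isMonHom a
    rw [hP a' ha', map_pt_one']

/-! ## §5 The count `#Img · #L = #A[𝔞]` -/

set_option maxHeartbeats 400000 in
/-- **THE COUNT OF THE IMAGE LINE: `#Img · #L = #A[𝔞]`** where `Img = {P″ ∈ A″[𝔞] | ∃ P ∈ A[𝔞], c P″ = q P}` (as a subgroup `S` given by its membership clause)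
and `L = K ∩ A[𝔞]` (`K = Ker q(Ω)`): `P″ ↦ c P″` is a bijection `Img ≃ q(A[𝔞])` (injective: §2; onto: the lift §3) and `#q(A[𝔞]) · #Ker(q|_{A[𝔞]}) = #A[𝔞]`
(Mathlib `Subgroup.card_mul_index`, `Subgroup.index_ker`). [cite: Liu2021, Prop. D.8 (1)(2) p. 135] [cite: MumfordAV1970, §7 Thm. 4 (p. 72)] -/
theorem natCard_imgLine_mul_natCard_eq [IsAlgClosed Ω] {𝔭 𝔞 : Ideal O} (h𝔭𝔞 : 𝔭 ⊔ 𝔞 = ⊤)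
    (K : Subgroup (A.toAffine.toAbelianVariety.Points Ω))
    (h1 : ∀ P : A.toAffine.toAbelianVariety.Points Ω, (AlgPoints.map q P : B.toAffine.toAbelianVariety.Points Ω) = 1 ↔ P ∈ K)
    (h2 : ∀ P : A''.toAffine.toAbelianVariety.Points Ω,
      (AlgPoints.map c P : B.toAffine.toAbelianVariety.Points Ω) = 1 ↔
        ∀ a ∈ 𝔭, (AlgPoints.map (act''.i a) P : A''.toAffine.toAbelianVariety.Points Ω) = 1)
    (h2s : Function.Surjective c.left.base)
    (h4 : ∀ a : O, ∃ b : B.X ⟶ B.X, act.i a ≫ q = q ≫ b ∧ act''.i a ≫ c = c ≫ b)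
    (S : Subgroup (A''.toAffine.toAbelianVariety.Points Ω))
    (hS : ∀ P'', P'' ∈ S ↔
      (∀ a ∈ 𝔞, (AlgPoints.map (act''.i a) P'' : A''.toAffine.toAbelianVariety.Points Ω) = 1) ∧
        ∃ P : A.toAffine.toAbelianVariety.Points Ω, (∀ a ∈ 𝔞, (AlgPoints.map (act.i a) P : A.toAffine.toAbelianVariety.Points Ω) = 1) ∧
          (AlgPoints.map c P'' : B.toAffine.toAbelianVariety.Points Ω) = AlgPoints.map q P)
    (L : Subgroup (A.toAffine.toAbelianVariety.Points Ω))
    (hL : ∀ P, P ∈ L ↔ P ∈ K ∧ ∀ a ∈ 𝔞, (AlgPoints.map (act.i a) P : A.toAffine.toAbelianVariety.Points Ω) = 1) :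
    Nat.card ↥S * Nat.card ↥L =
      Nat.card {P : A.toAffine.toAbelianVariety.Points Ω // ∀ a ∈ 𝔞, (AlgPoints.map (act.i a) P : A.toAffine.toAbelianVariety.Points Ω) = 1} := by
  classical
  -- the `𝔞`-torsion subgroup `T ≤ A(Ω)` and the restriction `φ := q|_T`
  let T : Subgroup (A.toAffine.toAbelianVariety.Points Ω) :=
    { carrier := {P | ∀ a ∈ 𝔞, (AlgPoints.map (act.i a) P : A.toAffine.toAbelianVariety.Points Ω) = 1}
      one_mem' := fun a _ => by haveI := act.isMonHom a; exact map_pt_one' _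
      mul_mem' := fun {P Q} hP hQ a ha => by haveI := act.isMonHom a; rw [map_pt_mul', hP a ha, hQ a ha, mul_one]
      inv_mem' := fun {P} hP a ha => by haveI := act.isMonHom a; rw [map_pt_inv', hP a ha, inv_one] }
  have hTmem : ∀ P, P ∈ T ↔ ∀ a ∈ 𝔞, (AlgPoints.map (act.i a) P : A.toAffine.toAbelianVariety.Points Ω) = 1 := fun P => Iff.rfl
  let φ : ↥T →* B.toAffine.toAbelianVariety.Points Ω := (IsMonHom.monoidHom q (specOver Ω Ω)).restrict T
  have hφ : ∀ P : ↥T, φ P = (AlgPoints.map q (P : A.toAffine.toAbelianVariety.Points Ω) : B.toAffine.toAbelianVariety.Points Ω) := fun P => rfl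
  -- `Ker φ ≃ L`
  have eker : ↥φ.ker ≃ ↥L :=
    { toFun := fun P => ⟨(P.1 : A.toAffine.toAbelianVariety.Points Ω), (hL _).2 ⟨(h1 _).1 (by rw [← hφ]; exact P.2), P.1.2⟩⟩
      invFun := fun P => ⟨⟨P.1, ((hL _).1 P.2).2⟩, by
        change φ _ = 1
        rw [hφ]; exact (h1 _).2 ((hL _).1 P.2).1⟩
      left_inv := fun P => rfl
      right_inv := fun P => rfl }
  -- `S ≃ range φ` via `c`
  have hSr : ∀ P'' : ↥S, (AlgPoints.map c (P'' : A''.toAffine.toAbelianVariety.Points Ω) : B.toAffine.toAbelianVariety.Points Ω) ∈ φ.range := fun P'' => by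
    obtain ⟨hP'', P, hP, hcP⟩ := (hS _).1 P''.2
    exact ⟨⟨P, hP⟩, by rw [hφ]; exact hcP.symm⟩
  have erange : ↥S ≃ ↥φ.range := by
    refine Equiv.ofBijective (fun P'' => ⟨_, hSr P''⟩) ⟨fun P'' Q'' h => ?_, fun β => ?_⟩
    · have h' := congrArg Subtype.val h
      exact Subtype.ext (eq_of_torsion_of_map_eq act'' c h𝔭𝔞 h2 ((hS _).1 P''.2).1 ((hS _).1 Q''.2).1 h')
    · obtain ⟨⟨P, hP⟩, hβ⟩ := β.2
      obtain ⟨P'', hP'', hcP⟩ := exists_torsion_map_eq_map_of_torsion act act'' q c h𝔭𝔞 h2 h2s h4 (P := P) hP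
      refine ⟨⟨P'', (hS _).2 ⟨hP'', P, hP, hcP⟩⟩, Subtype.ext ?_⟩
      change (AlgPoints.map c P'' : B.toAffine.toAbelianVariety.Points Ω) = β.1
      rw [hcP, ← hβ, hφ]
  -- count
  have hT : Nat.card ↥T = Nat.card {P : A.toAffine.toAbelianVariety.Points Ω //
      ∀ a ∈ 𝔞, (AlgPoints.map (act.i a) P : A.toAffine.toAbelianVariety.Points Ω) = 1} := rfl
  rw [← hT, ← Subgroup.card_mul_index φ.ker, Subgroup.index_ker, Nat.card_congr eker, Nat.card_congr erange, mul_comm]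

/-- **`#Img = n`** when `#A[𝔞] = n · n`, `#L = n`, `0 < n` (for the P6a roofs: `n = p^f`, so the image line IS a line).
[cite: Liu2021, Prop. D.8 (1)(2) p. 135] [cite: MumfordAV1970, §7 Thm. 4 (p. 72)] -/
theorem natCard_imgLine_eq_of_sq [IsAlgClosed Ω] {𝔭 𝔞 : Ideal O} (h𝔭𝔞 : 𝔭 ⊔ 𝔞 = ⊤)
    (K : Subgroup (A.toAffine.toAbelianVariety.Points Ω))
    (h1 : ∀ P : A.toAffine.toAbelianVariety.Points Ω, (AlgPoints.map q P : B.toAffine.toAbelianVariety.Points Ω) = 1 ↔ P ∈ K)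
    (h2 : ∀ P : A''.toAffine.toAbelianVariety.Points Ω,
      (AlgPoints.map c P : B.toAffine.toAbelianVariety.Points Ω) = 1 ↔
        ∀ a ∈ 𝔭, (AlgPoints.map (act''.i a) P : A''.toAffine.toAbelianVariety.Points Ω) = 1)
    (h2s : Function.Surjective c.left.base)
    (h4 : ∀ a : O, ∃ b : B.X ⟶ B.X, act.i a ≫ q = q ≫ b ∧ act''.i a ≫ c = c ≫ b)
    (S : Subgroup (A''.toAffine.toAbelianVariety.Points Ω))
    (hS : ∀ P'', P'' ∈ S ↔
      (∀ a ∈ 𝔞, (AlgPoints.map (act''.i a) P'' : A''.toAffine.toAbelianVariety.Points Ω) = 1) ∧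
        ∃ P : A.toAffine.toAbelianVariety.Points Ω, (∀ a ∈ 𝔞, (AlgPoints.map (act.i a) P : A.toAffine.toAbelianVariety.Points Ω) = 1) ∧
          (AlgPoints.map c P'' : B.toAffine.toAbelianVariety.Points Ω) = AlgPoints.map q P)
    (L : Subgroup (A.toAffine.toAbelianVariety.Points Ω))
    (hL : ∀ P, P ∈ L ↔ P ∈ K ∧ ∀ a ∈ 𝔞, (AlgPoints.map (act.i a) P : A.toAffine.toAbelianVariety.Points Ω) = 1)
    {n : ℕ} (hn : 0 < n)
    (hA : Nat.card {P : A.toAffine.toAbelianVariety.Points Ω // ∀ a ∈ 𝔞, (AlgPoints.map (act.i a) P : A.toAffine.toAbelianVariety.Points Ω) = 1} = n * n)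
    (hLn : Nat.card ↥L = n) : Nat.card ↥S = n := by
  have h := natCard_imgLine_mul_natCard_eq act act'' q c h𝔭𝔞 K h1 h2 h2s h4 S hS L hL
  rw [hA, hLn] at h
  exact Nat.eq_of_mul_eq_mul_right hn h

end AbelianSchemeOver

end Literature.AlgebraicGeometry.AbelianSchemes

end
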